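import Literature.Computability.Complexity.MerlinArthurTests
import Literature.Computability.Complexity.Promise
import HarnessLib

/-!
# The promise class `pr-MA` (textbook promise Merlin–Arthur) and its place between `pr-NP` and `MA`

Literature / complexity classes, companion of `Promise.lean` (promise problems; `PromiseP`,
`PromiseNP = promiseLift NP`, the textbook `PromiseBPP'`) and `ArthurMerlinGames.lean` (`MA = MA(2)`).
Hirahara's Lemma 3.4 (ECCC TR21-058, p. 20) quotes Köbler–Schuler 2004 in the form
"`coNP × {U} ⊆ Avg¹_{1-n^{-c}} P` implies `pr-MA = pr-NP`"; the tree had no promise version of `MA`.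
This file vendors it, on the model of `PromiseBPP'` (nothing is required off the promise) and of the
predicate form of `MA` (Impagliazzo–Kabanets–Wigderson 2002, §2.1: "`MA` … there is a polynomial-time
predicate `R(x, y, z)` … `x ∈ L ⟹ ∃ y Pr_z[R(x,y,z) = 1] ≥ 2/3`, `x ∉ L ⟹ ∀ y Pr_z[R(x,y,z) = 1] ≤ 1/3`,
`|y| = |z| = |x|^c`"; Arora–Barak Def. 8.10):

* `PromiseMA'` — `Q ∈ PromiseMA'` iff there are a referee `R ∈ P` (read on triples `⟨⟨x, y⟩, z⟩`) and a
  polynomial `p` (the common length of Merlin's message `y` and Arthur's coins `z`) such that on every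
  yes-instance SOME `y ∈ {0,1}^{p(|x|)}` is accepted with probability `≥ 2/3` over `z ∈ {0,1}^{p(|x|)}`,
  and on every no-instance EVERY `y ∈ {0,1}^{p(|x|)}` is accepted with probability `≤ 1/3`;
* `PromiseNP_subset_PromiseMA'` — `pr-NP ⊆ pr-MA` (Merlin sends the padded `NP` certificate, Arthur
  ignores his coins; the trivial half of "`pr-MA = pr-NP`");
* `ofLanguage_mem_PromiseMA'_of_mem_MA` — a language in the tree's game class `MA` is, as a promise
  problem with trivial promise, in `PromiseMA'` (the value of the `[merlin, arthur]` game is the maximum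
  over Merlin's messages of Arthur's acceptance probability, `MerlinArthurTests.lean`);
* `MA_subset_NP_of_PromiseMA'_subset_PromiseNP` — hence `pr-MA ⊆ pr-NP ⟹ MA ⊆ NP`.

Everything is proved except the definition itself. Mathlib has no promise or Arthur–Merlin classes;
nothing duplicates the tree (searched `PromiseMA`, `prMA`, `promise.*Merlin`: none).

## References

* R. Impagliazzo, V. Kabanets, A. Wigderson, *In search of an easy witness*, JCSS 65 (2002), §2.1
  (`MA` by a predicate `R(x, y, z)`, `|y| = |z| = |x|^c`) [ImpagliazzoKabanetsWigderson2002].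
* O. Goldreich, *On promise problems: a survey*, LNCS 3895 (2006), §1.1–1.2, Def. 1.2 (promise classes;
  nothing is required outside the promise) [Goldreich2006].
* S. Arora, B. Barak, *Computational Complexity: A Modern Approach*, CUP 2009, Def. 8.10 (`MA`), §8.2
  [AroraBarakCC2009].
* S. Hirahara, ECCC TR21-058 (2021), Lemma 3.4, proof sketch, item 2 ("pr-MA = pr-NP" [KS04])
  [Hirahara2021].
-/

noncomputable section

namespace Literature.Computability.Complexity

open _root_.Computability Finset Brick

/-! ### The class -/

/-- **`PromiseMA'`, the textbook class promise-`MA`.** `Q ∈ PromiseMA'` iff there are `R ∈ P` and a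
polynomial `p` such that: on every yes-instance `x` some message `y` of length `p |x|` has
`Pr_{z ∈ {0,1}^{p |x|}}[⟨⟨x, y⟩, z⟩ ∈ R] ≥ 2/3`, and on every no-instance `x` every message `y` of length
`p |x|` has that probability `≤ 1/3`; nothing is required off the promise (compare `PromiseBPP'`).
Merlin's message and Arthur's coins have the common length `p |x|` (IKW: "`|y| = |z| = |x|^c`").
[Impagliazzo–Kabanets–Wigderson 2002, §2.1; Goldreich 2006, Def. 1.2; Arora–Barak 2009, Def. 8.10]
[cite: ImpagliazzoKabanetsWigderson2002, §2.1] -/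
def PromiseMA' : Set PromiseProblem :=
  {Q | ∃ R ∈ Classes.P, ∃ p : Polynomial ℕ,
    (∀ x ∈ Q.yes, ∃ y : List Bool, y.length = p.eval x.length ∧
        2 / 3 ≤ uniformProb (p.eval x.length) {z : List Bool | boolPair (boolPair x y) z ∈ R}) ∧
    (∀ x ∈ Q.no, ∀ y : List Bool, y.length = p.eval x.length →
        uniformProb (p.eval x.length) {z : List Bool | boolPair (boolPair x y) z ∈ R} ≤ 1 / 3)}

/-- Unfolding lemma for `PromiseMA'`. [cite: ImpagliazzoKabanetsWigderson2002, §2.1] -/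
theorem mem_PromiseMA'_iff {Q : PromiseProblem} :
    Q ∈ PromiseMA' ↔ ∃ R ∈ Classes.P, ∃ p : Polynomial ℕ,
      (∀ x ∈ Q.yes, ∃ y : List Bool, y.length = p.eval x.length ∧
          2 / 3 ≤ uniformProb (p.eval x.length) {z : List Bool | boolPair (boolPair x y) z ∈ R}) ∧
      (∀ x ∈ Q.no, ∀ y : List Bool, y.length = p.eval x.length →
          uniformProb (p.eval x.length) {z : List Bool | boolPair (boolPair x y) z ∈ R} ≤ 1 / 3) :=
  Iff.rfl

/-! ### `pr-NP ⊆ pr-MA` -/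

/-- Pointwise pairing of two `FP` functions is in `FP` (local helper). [folklore] -/
private theorem pairF_mem_FP {f g : List Bool → List Bool} (hf : f ∈ FP) (hg : g ∈ FP) :
    (fun z => boolPair (f z) (g z)) ∈ FP := by
  have h : (fun z => boolPair (f z) (g z)) = fanoutFn f g := funext fun z => (fanoutFn_apply f g z).symm
  rw [h]
  exact fanoutFn_mem_FP hf hg

/-- Reading `⟨⟨x, y⟩, z⟩ ↦ ⟨x, fst y⟩` (the input and the certificate carried by Merlin's message). [folklore] -/
private def readCert : List Bool → List Bool := fun w => boolPair (fstF (fstF w)) (fstF (sndF (fstF w)))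

/-- `readCert ∈ FP`. [folklore] -/
private theorem readCert_mem_FP : readCert ∈ FP :=
  pairF_mem_FP (comp_mem_FP fstF_mem_FP fstF_mem_FP)
    (comp_mem_FP fstF_mem_FP (comp_mem_FP sndF_mem_FP fstF_mem_FP))

/-- Value of `readCert` on a triple whose message is a pair. [folklore] -/
private theorem readCert_apply (x u v z : List Bool) :
    readCert (boolPair (boolPair x (boolPair u v)) z) = boolPair x u := by
  unfold readCert
  rw [fstF_boolPair, fstF_boolPair, sndF_boolPair, fstF_boolPair]

/-- Membership in a set-builder language (local `Iff.rfl` helper). [folklore] -/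
private theorem memL_setOf' {q : List Bool → Prop} {w : List Bool} :
    @Membership.mem (List Bool) (Language Bool) _ {z | q z} w ↔ q w := Iff.rfl

/-- The referee of the simulation of `pr-NP`: `|u| ≤ p(|x|)` and `⟨x, u⟩ ∈ L'`, `u = fst y`. [folklore] -/
private def npRef (p : Polynomial ℕ) (L' : Language Bool) : Language Bool :=
  {w | readCert w ∈ LenLe p ∧ readCert w ∈ L'}

/-- `npRef` is the preimage of `LenLe p ⊓ L'` under `readCert` (definitionally). [folklore] -/
private theorem npRef_eq (p : Polynomial ℕ) (L' : Language Bool) :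
    npRef p L' = readCert ⁻¹' (LenLe p ⊓ L') := rfl

/-- The referee of the simulation is in `P`. [folklore] -/
private theorem npRef_mem_P (p : Polynomial ℕ) {L' : Language Bool} (hL' : L' ∈ Classes.P) : npRef p L' ∈ Classes.P := by
  rw [npRef_eq]
  exact preimage_mem_P (inter_mem_P (LenLe_mem_P p) hL') readCert_mem_FP

/-- Reading the referee on an honest message. [folklore] -/
private theorem mem_npRef_iff (p : Polynomial ℕ) (L' : Language Bool) (x u v z : List Bool) :
    boolPair (boolPair x (boolPair u v)) z ∈ npRef p L' ↔ u.length ≤ p.eval x.length ∧ boolPair x u ∈ L' := by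
  rw [npRef, memL_setOf', readCert_apply, boolPair_mem_LenLe]

/-- Reading the referee on an arbitrary message. [folklore] -/
private theorem mem_npRef_imp (p : Polynomial ℕ) (L' : Language Bool) (x y z : List Bool)
    (h : boolPair (boolPair x y) z ∈ npRef p L') : (fstF y).length ≤ p.eval x.length ∧ boolPair x (fstF y) ∈ L' := by
  rw [npRef, memL_setOf'] at h
  unfold readCert at h
  rw [fstF_boolPair, fstF_boolPair, sndF_boolPair, boolPair_mem_LenLe] at h
  exact h

/-- **`pr-NP ⊆ pr-MA`**: Merlin sends the `NP` certificate `u` (padded to a message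
`⟨u, 0…0⟩` of the exact length `2 p(|x|) + 2`), Arthur checks `|u| ≤ p(|x|)` and the verifier and
ignores his coins; on a no-instance no message is ever accepted. [Arora–Barak 2009, §8.2 (`NP ⊆ MA`);
Goldreich 2006, §1.2] [cite: AroraBarakCC2009, §8.2] -/
theorem PromiseNP_subset_PromiseMA' : PromiseNP ⊆ PromiseMA' := by
  intro Q hQ
  obtain ⟨L, hL, hyes, hno⟩ := hQ
  obtain ⟨L', hL', p, hp⟩ := hL
  refine ⟨npRef p L', npRef_mem_P p hL', 2 * p + 2, fun x hx => ?_, fun x hx y _ => ?_⟩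
  · -- yes: the padded certificate is accepted with probability one
    obtain ⟨u, hu, hxu⟩ := (hp x).1 (hyes hx)
    set pad : List Bool := List.replicate (2 * p.eval x.length - 2 * u.length) false with hpad
    refine ⟨boolPair u pad, ?_, ?_⟩
    · simp only [hpad, length_boolPair, List.length_replicate, Polynomial.eval_add, Polynomial.eval_mul,
        Polynomial.eval_ofNat]
      omega
    · have hall : ∀ z : List Bool, boolPair (boolPair x (boolPair u pad)) z ∈ npRef p L' :=
        fun z => (mem_npRef_iff p L' x u pad z).2 ⟨hu, hxu⟩
      have hset : {z : List Bool | boolPair (boolPair x (boolPair u pad)) z ∈ npRef p L'} = Set.univ :=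
        Set.eq_univ_of_forall hall
      rw [hset, uniformProb_univ]
      norm_num
  · -- no: no message is accepted at all
    have hnone : {z : List Bool | boolPair (boolPair x y) z ∈ npRef p L'} = ∅ := by
      refine Set.eq_empty_of_forall_notMem fun z hz => ?_
      have hz' : boolPair (boolPair x y) z ∈ npRef p L' := hz
      obtain ⟨hlen, hmem⟩ := mem_npRef_imp p L' x y z hz'
      exact hno hx ((hp x).2 ⟨fstF y, hlen, hmem⟩)
    rw [hnone, uniformProb_empty]
    norm_num

/-! ### `MA` inside `pr-MA`; `pr-MA ⊆ pr-NP ⟹ MA ⊆ NP` -/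

/-- **A language of `MA` is a `PromiseMA'` problem with trivial promise.** The referee is read on
triples (`AMTwo.toRefFn ⁻¹' Ref`, `MerlinArthurTests.mem_preimage_toRefFn_iff`); the value of the
`[merlin, arthur]` game is `≥ 2/3` iff some message is accepted with probability `≥ 2/3`, and `≤ 1/3`
bounds every message (`exists_le_uniformProb_of_le_amValue`, `forall_uniformProb_le_of_amValue_le`).
[cite: AroraBarakCC2009, Def. 8.10] [cite: BabaiMoran1988, §2.3] -/
theorem ofLanguage_mem_PromiseMA'_of_mem_MA {L : Language Bool} (hL : L ∈ MA) :
    PromiseProblem.ofLanguage L ∈ PromiseMA' := by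
  obtain ⟨Ref, hRef, m, hgame⟩ := mem_MA_iff.1 hL
  have hset : ∀ x y : List Bool,
      {z : List Bool | boolPair (boolPair x y) z ∈ (AMTwo.toRefFn ⁻¹' Ref : Language Bool)} =
        {z | boolPair x (encMoves [y, z]) ∈ Ref} := by
    intro x y
    ext z
    exact MATests.mem_preimage_toRefFn_iff Ref x y z
  refine ⟨AMTwo.toRefFn ⁻¹' Ref, preimage_mem_P hRef AMTwo.toRefFn_mem_FP, m, fun x hx => ?_, fun x hx y hy => ?_⟩
  · obtain ⟨y, hy⟩ := exists_le_uniformProb_of_le_amValue ((hgame x).1 hx)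
    refine ⟨y.toList, y.toList_length, ?_⟩
    exact hy.trans (le_of_eq (congrArg (uniformProb _) (hset x y.toList).symm))
  · have h := forall_uniformProb_le_of_amValue_le ((hgame x).2 hx) ⟨y, hy⟩
    exact (le_of_eq (congrArg (uniformProb _) (hset x y))).trans h

/-- **`pr-MA ⊆ pr-NP ⟹ MA ⊆ NP`** (the language form of a promise-class inclusion, through the trivial
promise: `ofLanguage L ∈ promiseLift C ↔ L ∈ C`). [cite: Goldreich2006, §1.1] -/
theorem MA_subset_NP_of_PromiseMA'_subset_PromiseNP (h : PromiseMA' ⊆ PromiseNP) :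
    MA ⊆ Nondeterministic.NP := fun _ hL =>
  ofLanguage_mem_promiseLift_iff.1 (h (ofLanguage_mem_PromiseMA'_of_mem_MA hL))

end Literature.Computability.Complexity

end
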